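import Mathlib.Topology.MetricSpace.ProperSpace
import Mathlib.Analysis.InnerProductSpace.PiL2
import Literature.Topology.FourManifolds.AnnulusPairConnectivity

/-!
# Stub `stub_euclideanOneEnd` of line `universal-cover-strips-topology`
(crux `InformationMetricHadamard.AhHadamardFilling`)

`ℝ⁵` has one end (Freudenthal): two disjoint open subsets of `ℝ⁵` with compact frontiers cannot
both have non-compact closure.  Proof: the frontier of `V₁` lies in a closed ball `B̄_R`; the
complement `A = ℝ⁵ ∖ B̄_R` is preconnected (dimension `5 ≥ 2`,
`Literature.Topology.FourManifolds.isPreconnected_compl_closedBall_zero`) and misses `∂V₁`, so it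
lies inside the open set `V₁` or inside the open set `(cl V₁)ᶜ`.  In the second case `cl V₁ ⊆ B̄_R`
is compact; in the first case `V₂ ⊆ V₁ᶜ ⊆ B̄_R`, so `cl V₂` is compact.  (Only the compactness of
`∂V₁` is used.)  Everything is proved (kind = proof); no definitions.
-/

noncomputable section

-- the prescribed namespace `Summit.<P>.<Sub>.…` duplicates `SmoothPoincare4` (P = Sub)
set_option linter.dupNamespace false

open Set Function

namespace Summit.SmoothPoincare4.SmoothPoincare4.Cruxes.AhHadamardFilling.UniversalCoverStripsTopology

/-- An open subset of `ℝ⁵` whose frontier lies in the closed ball `B̄_R` either contains the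
complement of `B̄_R` or has closure inside `B̄_R` (the complement of a closed ball in `ℝⁿ`,
`n ≥ 2`, is connected). [folklore] -/
theorem compl_closedBall_subset_or_closure_subset {V : Set (EuclideanSpace ℝ (Fin 5))}
    (hV : IsOpen V) {R : ℝ}
    (hR : frontier V ⊆ Metric.closedBall (0 : EuclideanSpace ℝ (Fin 5)) R) :
    (Metric.closedBall (0 : EuclideanSpace ℝ (Fin 5)) R)ᶜ ⊆ V ∨
      closure V ⊆ Metric.closedBall (0 : EuclideanSpace ℝ (Fin 5)) R := by
  have hA : IsPreconnected (Metric.closedBall (0 : EuclideanSpace ℝ (Fin 5)) R)ᶜ :=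
    Literature.Topology.FourManifolds.isPreconnected_compl_closedBall_zero (n := 5) (by norm_num) R
  -- `A ⊆ V ∪ (closure V)ᶜ`: a point of `A` in `closure V` is not on the frontier, hence in `V`.
  have hsub : (Metric.closedBall (0 : EuclideanSpace ℝ (Fin 5)) R)ᶜ ⊆ V ∪ (closure V)ᶜ := by
    intro x hx
    by_cases hxc : x ∈ closure V
    · left
      by_contra hxV
      have hxf : x ∈ frontier V := by
        rw [hV.frontier_eq]
        exact ⟨hxc, hxV⟩
      exact hx (hR hxf)
    · exact Or.inr hxc
  have hdisj : Disjoint V (closure V)ᶜ :=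
    disjoint_compl_right.mono_left subset_closure
  rcases hA.subset_or_subset hV isClosed_closure.isOpen_compl hdisj hsub with h | h
  · exact Or.inl h
  · right
    intro x hx
    by_contra hxR
    exact h hxR hx

/-- **S1 (`euclideanOneEnd`).** Two disjoint open subsets of `ℝ⁵` with compact frontiers cannot
both have non-compact closure: if the frontier of `V₁` lies in the closed ball `B̄_R`, the connected
set `ℝ⁵ ∖ B̄_R` (dimension `≥ 2`) misses it, so it lies inside `V₁` or misses `cl V₁`; in the
latter case `cl V₁ ⊆ B̄_R` is compact, in the former `V₂ ⊆ V₁ᶜ ⊆ B̄_R` has compact closure.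
(The one-endedness of `ℝⁿ`, `n ≥ 2`, in Freudenthal's sense.) [folklore] -/
theorem stub_euclideanOneEnd :
    ∀ (V₁ V₂ : Set (EuclideanSpace ℝ (Fin 5))), IsOpen V₁ → IsOpen V₂ → Disjoint V₁ V₂ →
      IsCompact (frontier V₁) → IsCompact (frontier V₂) →
      IsCompact (closure V₁) ∨ IsCompact (closure V₂) := by
  intro V₁ V₂ hV₁ _hV₂ hdisj hf₁ _hf₂
  obtain ⟨R, hR⟩ := hf₁.isBounded.subset_closedBall (0 : EuclideanSpace ℝ (Fin 5))
  have hball : IsCompact (Metric.closedBall (0 : EuclideanSpace ℝ (Fin 5)) R) :=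
    isCompact_closedBall _ _
  rcases compl_closedBall_subset_or_closure_subset hV₁ hR with h | h
  · -- `A ⊆ V₁`, so `V₂ ⊆ V₁ᶜ ⊆ Aᶜ = B̄_R` and `cl V₂ ⊆ B̄_R` is compact.
    right
    have hV₂sub : V₂ ⊆ Metric.closedBall (0 : EuclideanSpace ℝ (Fin 5)) R := by
      intro x hx
      by_contra hxR
      exact hdisj.ne_of_mem (h hxR) hx rfl
    exact hball.of_isClosed_subset isClosed_closure
      (closure_minimal hV₂sub Metric.isClosed_closedBall)
  · -- `cl V₁ ⊆ B̄_R` is compact.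
    exact Or.inl (hball.of_isClosed_subset isClosed_closure h)

end Summit.SmoothPoincare4.SmoothPoincare4.Cruxes.AhHadamardFilling.UniversalCoverStripsTopology
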